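import Literature.AnabelianGeometry.AbsoluteAnabelian.AbsTopIII.CyclotomeSynchronizationSchemata
import Literature.AnabelianGeometry.AbsoluteAnabelian.AbsTopIII.CcnTransgression
import HarnessLib

/-!
# [AbsTopIII] Thm. 1.9 (b) over the bare `CurveModel` interface is independent of the WHOLE Prop. 1.4
# package: the third curve `Z ∖ {z}` is load-bearing (F-0346 vs F-0338 / F-0339 / F-0340 / F-0341 / F-0365)

S. Mochizuki, *Topics in Absolute Anabelian Geometry III*, §1 (kurims manuscript, lit key
`paper:url-5493eb38cbb7`): Prop. 1.4 (i)/(ii) p. 31; Thm. 1.9 (b) p. 37 "One constructs the natural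
isomorphisms `I_z ⥲ μ_Ẑ(Π_U) := M_Z` — where `U ⊆ Y → X` is as in (a) [...] the points of `Z ∖ U` are all
rational [...] — via the technique of Proposition 1.4, (ii)."  Cell abc-iut, block F, seat
abc-iut-f-079 (tranche 79); third file of the F-0346 / F-0348 record (after
`CyclotomeSynchronizationSchemata.lean` p429113 and `…SchemataPropOneFour.lean` p430280).  PROOF-ONLY
(no `def`, no instance, no named fact; the witness is built inside the theorem term).

abc-iut-L4-t1's typing note on `CurveModel.Thm_1_9_b` records that the several-cusps statement
"reduces to [the single-cusp natural form] through `U ⊆ Z ∖ {z} ⊆ Z` and Prop. 1.4 (i), a transport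
`CurveModel` cannot express without a third curve"; the conditional discharge
`CoherentKummerModel.thm_1_9_b` (`Thm19bPresentationsProofs.lean`) accordingly uses the model-closure
law `exists_open_between` of `CoherentKummerModel` besides the four Prop. 1.4 named facts.  This file
makes the dependence KERNEL-VISIBLE:

* `CurveModel.not_forall_thm_1_9_b_of_prop_1_4_package` — the joint closure
  `∀ M : CurveModel, Prop_1_4_i M → Prop_1_4_i' M → Prop_1_4_ii M → Prop_1_4_ii_sync M →
  Prop_1_4_ii_transgression M → Thm_1_9_b M` is FALSE (universe `0`).  WITNESS (not a model of any
  curve): `U ↦ Π_U = (Ẑ × Ẑ) × G_ℚ ↠ G_ℚ` with TWO rational cusps `z₁, z₂` whose inertia groups are the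
  two factors `Ẑ × 1`, `1 × Ẑ` (decomposition groups the kernels of the two coordinate projections);
  `Z ↦` the point extension `Π_Z = G_ℚ`; `res = pr₂`, whose kernel `Δ_U = Ẑ × Ẑ` is the closed normal
  closure of `I_{z₁} ∪ I_{z₂}` — so Prop. 1.4 (i) and (i′) HOLD — but is NOT the closed normal closure
  of a single `I_{z_i}`, so `(U ⊆ Z, z_i)` is NOT a cyclotome presentation and Prop. 1.4 (ii), (ii)-sync
  (F-0365) and the transgression fact (F-0338) hold VACUOUSLY; yet `M_Z = Hom(H²(1, Ẑ), Ẑ)` is trivial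
  while `I_{z₁} ≅ Ẑ`.  In the intended geometry the missing curve `Z ∖ {z₁}` between `U` and `Z` is what
  turns `(Z ∖ {z₁} ⊆ Z, z₁)` into a cyclotome presentation; the bare interface has no such object.

HONEST FRAMING: a statement about OUR typed interface (R5: F-0346 is consumable only at a named,
law-abiding model), not about print's Thm. 1.9 / Prop. 1.4; typed ≠ proved; nothing here bears on the
disputed [IUTchIII] Cor. 3.12; no side taken.
-/

noncomputable section

open CategoryTheory Topology
open scoped Pointwise

namespace Literature.AnabelianGeometry.AbsoluteAnabelian

namespace AbsTopIII

namespace CurveModel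

open FundamentalExtension

/-- **F-0346 is independent of F-0339 ∧ F-0340 ∧ F-0341 ∧ F-0365 ∧ F-0338 over the bare interface**
(universe `0`): "`∀ M, Prop_1_4_i M → Prop_1_4_i' M → Prop_1_4_ii M → Prop_1_4_ii_sync M →
Prop_1_4_ii_transgression M → Thm_1_9_b M`" is false.  Witness: `Π_U = (Ẑ × Ẑ) × G_ℚ ↠ G_ℚ` with two
rational cusps of inertia `Ẑ × 1` and `1 × Ẑ`, `Π_Z = G_ℚ`, `res = pr₂` (kernel `Ẑ × Ẑ` = the closed
normal closure of BOTH inertia groups, of neither alone): (i), (i′) hold, every presentation-guarded fact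
((ii), (ii)-sync, transgression) holds vacuously, and `M_Z` is trivial while `I_{z₁} ≅ Ẑ`
(`isFreeProcyclic_zHatCompletion`, `CyclotomeMod.subsingleton_of_geom_eq_bot`,
`not_isFreeProcyclic_of_subsingleton`).  So over `CurveModel` the several-cusps Thm. 1.9 (b) needs the
third curve `Z ∖ {z}` (the law `CoherentKummerModel.exists_open_between` of the conditional lane), not
only the Prop. 1.4 named facts. [cite: MochizukiAbsTopIII2015, Thm 1.9 (b) p.37]
[cite: MochizukiAbsTopIII2015, Prop 1.4 (ii) p.31] -/
theorem not_forall_thm_1_9_b_of_prop_1_4_package :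
    ¬ ∀ M : CurveModel.{0}, M.Prop_1_4_i → M.Prop_1_4_i' → M.Prop_1_4_ii → M.Prop_1_4_ii_sync →
      M.Prop_1_4_ii_transgression →
      Literature.AnabelianGeometry.AbsoluteAnabelian.AbsTopIII.CurveModel.Thm_1_9_b M := by
  intro h
  let Γ : ProfiniteGrp.{0} := absoluteGaloisGrp ℚ
  let Z : ProfiniteGrp.{0} := ProfiniteGrp.ProfiniteCompletion.completion (GrpCat.of (Multiplicative ℤ))
  -- `Π_U = (Ẑ × Ẑ) × G_ℚ ↠ G_ℚ` and the point extension `Π_Z = G_ℚ`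
  let EU : FundamentalExtension.{0} :=
    { arith := ProfiniteGrp.of ((Z × Z) × Γ), gal := Γ, aug := ContinuousMonoidHom.snd (Z × Z) Γ,
      aug_surjective := Prod.snd_surjective }
  let Ept : FundamentalExtension.{0} :=
    { arith := Γ, gal := Γ, aug := ContinuousMonoidHom.id _, aug_surjective := Function.surjective_id }
  have hEpt : Ept.geom = ⊥ := (MonoidHom.ker_eq_bot_iff _).mpr Function.injective_id
  -- a nontrivial element `t ∈ Ẑ`
  haveI : Nontrivial Z := not_subsingleton_iff_nontrivial.1 fun hZ =>
    @not_isFreeProcyclic_of_subsingleton _ _ _ hZ isFreeProcyclic_zHatCompletion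
  obtain ⟨t, ht⟩ := exists_ne (1 : Z)
  -- the coordinate projections: cusp `false` ↦ second coordinate, cusp `true` ↦ first coordinate
  let κ : Bool → ((Z × Z) × Γ →* Z) := fun b =>
    cond b ((MonoidHom.fst Z Z).comp (MonoidHom.fst (Z × Z) Γ))
      ((MonoidHom.snd Z Z).comp (MonoidHom.fst (Z × Z) Γ))
  have hκc : ∀ b, Continuous (κ b) := by
    rintro (_ | _)
    · exact continuous_snd.comp continuous_fst
    · exact continuous_fst.comp continuous_fst
  -- two cusps: `D_{z_b} = Ker κ_b`, `I_{z_b} = D_{z_b} ∩ Δ_U` (= `Ẑ × 1 × 1` resp. `1 × Ẑ × 1`)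
  let CU : EU.CuspidalData :=
    { Cusp := Bool
      Dcusp := fun b => (κ b).ker
      Icusp := fun b => (κ b).ker ⊓ EU.geom
      Icusp_eq := fun _ => rfl
      isClosed_Dcusp := fun b => by
        rw [MonoidHom.coe_ker]
        exact isClosed_singleton.preimage (hκc b)
      eq_of_conj := by
        rintro (_ | _) (_ | _) g hxy
        · rfl
        · exfalso
          rw [Subgroup.Normal.conj_smul_eq_self] at hxy
          have hu : (((t, 1), 1) : (Z × Z) × Γ) ∈ (κ false).ker := (MonoidHom.mem_ker).2 rfl
          rw [hxy, MonoidHom.mem_ker] at hu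
          exact ht hu
        · exfalso
          rw [Subgroup.Normal.conj_smul_eq_self] at hxy
          have hu : (((1, t), 1) : (Z × Z) × Γ) ∈ (κ true).ker := (MonoidHom.mem_ker).2 rfl
          rw [hxy, MonoidHom.mem_ker] at hu
          exact ht hu
        · rfl }
  have hmemF : ∀ a : Z, (((a, 1), 1) : (Z × Z) × Γ) ∈ CU.Icusp false := fun a =>
    Subgroup.mem_inf.2 ⟨(MonoidHom.mem_ker).2 rfl, EU.mem_geom.2 rfl⟩
  have hmemT : ∀ a : Z, (((1, a), 1) : (Z × Z) × Γ) ∈ CU.Icusp true := fun a =>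
    Subgroup.mem_inf.2 ⟨(MonoidHom.mem_ker).2 rfl, EU.mem_geom.2 rfl⟩
  -- both inertia groups are `≅ Ẑ`
  have hfree : ∀ b, IsFreeProcyclic (CU.Icusp b) := by
    rintro (_ | _)
    · refine isFreeProcyclic_zHatCompletion.of_continuousMulEquiv
        { toFun := fun a => ⟨((a, 1), 1), hmemF a⟩
          invFun := fun x => x.1.1.1
          left_inv := fun _ => rfl
          right_inv := fun x => Subtype.ext (Prod.ext (Prod.ext rfl
            ((MonoidHom.mem_ker).1 (Subgroup.mem_inf.1 x.2).1).symm)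
            (EU.mem_geom.1 (Subgroup.mem_inf.1 x.2).2).symm)
          map_mul' := fun a a' => Subtype.ext (Prod.ext (Prod.ext rfl (mul_one _).symm)
            (mul_one _).symm)
          continuous_toFun :=
            ((continuous_id.prodMk continuous_const).prodMk continuous_const).subtype_mk hmemF
          continuous_invFun := continuous_fst.comp (continuous_fst.comp continuous_subtype_val) }
    · refine isFreeProcyclic_zHatCompletion.of_continuousMulEquiv
        { toFun := fun a => ⟨((1, a), 1), hmemT a⟩
          invFun := fun x => x.1.1.2
          left_inv := fun _ => rfl
          right_inv := fun x => Subtype.ext (Prod.ext (Prod.ext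
            ((MonoidHom.mem_ker).1 (Subgroup.mem_inf.1 x.2).1).symm rfl)
            (EU.mem_geom.1 (Subgroup.mem_inf.1 x.2).2).symm)
          map_mul' := fun a a' => Subtype.ext (Prod.ext (Prod.ext (mul_one _).symm rfl)
            (mul_one _).symm)
          continuous_toFun :=
            ((continuous_const.prodMk continuous_id).prodMk continuous_const).subtype_mk hmemT
          continuous_invFun := continuous_snd.comp (continuous_fst.comp continuous_subtype_val) }
  let Cpt : Ept.CuspidalData :=
    { Cusp := PEmpty
      Dcusp := fun c => c.elim
      Icusp := fun c => c.elim
      Icusp_eq := fun c => c.elim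
      isClosed_Dcusp := fun c => c.elim
      eq_of_conj := fun c => c.elim }
  -- `res = pr₂ : Π_U ↠ Π_Z`, kernel `Δ_U = Ẑ × Ẑ × 1`
  let r : EU ⟶ Ept := ⟨ContinuousMonoidHom.snd (Z × Z) Γ, ContinuousMonoidHom.id _, fun _ => rfl⟩
  have hker : r.arith.toMonoidHom.ker = EU.geom := rfl
  haveI : EU.geom.Normal := EU.normal_geom
  -- (A) `Δ_U` is the closed normal closure of `I_{z₁} ∪ I_{z₂}` (Prop. 1.4 (i'))
  have hA : (Subgroup.normalClosure (⋃ c ∈ (Set.univ : Set Bool),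
      ((CU.Icusp c : Subgroup EU.arith) : Set EU.arith))).topologicalClosure = EU.geom := by
    refine le_antisymm (Subgroup.topologicalClosure_minimal _ (Subgroup.normalClosure_le_normal
      (Set.iUnion₂_subset fun c _ => SetLike.coe_subset_coe.2 inf_le_right)) EU.isClosed_geom) ?_
    intro x hx
    have hx2 : x.2 = 1 := EU.mem_geom.1 hx
    have hxeq : x = (((x.1.1, 1), 1) : (Z × Z) × Γ) * ((1, x.1.2), 1) :=
      Prod.ext (Prod.ext (mul_one _).symm (one_mul _).symm) (by rw [hx2]; exact (mul_one _).symm)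
    rw [hxeq]
    exact Subgroup.le_topologicalClosure _ (mul_mem
      (Subgroup.subset_normalClosure (Set.mem_iUnion₂.2 ⟨false, Set.mem_univ _, hmemF x.1.1⟩))
      (Subgroup.subset_normalClosure (Set.mem_iUnion₂.2 ⟨true, Set.mem_univ _, hmemT x.1.2⟩)))
  -- (B) but `Δ_U` is NOT the closed normal closure of a single `I_{z_i}`: no cyclotome presentation
  have hB : ∀ x : Bool, cuspidalKernel r ≠
      (Subgroup.normalClosure ((CU.Icusp x : Subgroup EU.arith) : Set EU.arith)).topologicalClosure := by
    intro x hx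
    have hu : (cond x (((t, 1), 1) : (Z × Z) × Γ) ((1, t), 1)) ∈ cuspidalKernel r :=
      Subgroup.mem_inf.2 ⟨(MonoidHom.mem_ker).2 (by cases x <;> rfl),
        EU.mem_geom.2 (by cases x <;> rfl)⟩
    rw [hx] at hu
    have hle : (Subgroup.normalClosure ((CU.Icusp x : Subgroup EU.arith) : Set EU.arith)).topologicalClosure
        ≤ (κ x).ker :=
      Subgroup.topologicalClosure_minimal _
        (Subgroup.normalClosure_le_normal (SetLike.coe_subset_coe.2 inf_le_left)) (CU.isClosed_Dcusp x)
    have h1 := (MonoidHom.mem_ker).1 (hle hu)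
    cases x
    · exact ht h1
    · exact ht h1
  -- the interface
  let ext : ULift.{1, 0} Bool → FundamentalExtension.{0} := fun b => cond b.down EU Ept
  let M : CurveModel.{0} :=
    { Curve := ULift.{1, 0} Bool
      base := fun _ => ℚ
      ext := ext
      galIso := fun b => Bool.rec (motive := fun c => ((cond c EU Ept).gal ≅ absoluteGaloisGrp ℚ))
        (Iso.refl _) (Iso.refl _) b.down
      cusps := fun b => Bool.rec (motive := fun c => (cond c EU Ept).CuspidalData) Cpt CU b.down
      IsProper := fun _ => True
      IsScheme := fun _ => True
      genus := fun _ => 2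
      FunctionField := fun _ => ℚ
      Point := fun _ => PEmpty
      decomp := fun _ x => x.elim
      IsNFCurve := fun _ => False
      IsNFPoint := fun _ x => x.elim
      IsNFRational := fun _ _ => False
      IsNFConstant := fun _ _ => False
      NFFunctionField := fun _ => ℚ
      IsStrictlyBelyiType := fun _ => False
      IsCofiniteOpen := fun U U' => U.down = true ∧ U'.down = false
      res := fun {U U'} hUU' => match U, U', hUU' with
        | ⟨true⟩, ⟨false⟩, _ => r
        | ⟨true⟩, ⟨true⟩, hUU' => Bool.noConfusion hUU'.2
        | ⟨false⟩, _, hUU' => Bool.noConfusion hUU'.1 }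
  -- Prop. 1.4 (i) holds
  have h14i : M.Prop_1_4_i := by
    rintro ⟨_ | _⟩ -
    · exact fun c => c.elim
    · exact hfree
  -- Prop. 1.4 (i') holds (by (A))
  have h14 : M.Prop_1_4_i' := by
    rintro ⟨_ | _⟩ ⟨_ | _⟩ hUU' - -
    · exact Bool.noConfusion hUU'.1
    · exact Bool.noConfusion hUU'.1
    · refine ⟨Prod.snd_surjective, Function.bijective_id, Set.univ, ?_⟩
      change r.arith.toMonoidHom.ker = (Subgroup.normalClosure (⋃ c ∈ (Set.univ : Set Bool),
        ((CU.Icusp c : Subgroup EU.arith) : Set EU.arith))).topologicalClosure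
      rw [hker, hA]
    · exact Bool.noConfusion hUU'.2
  -- Prop. 1.4 (ii), (ii)-sync and the transgression fact hold VACUOUSLY (by (B))
  have h142 : M.Prop_1_4_ii := by
    rintro ⟨_ | _⟩ ⟨_ | _⟩ hUU' - - - x - hkx
    · exact Bool.noConfusion hUU'.1
    · exact Bool.noConfusion hUU'.1
    · exact absurd hkx (hB x)
    · exact Bool.noConfusion hUU'.2
  have hsync : M.Prop_1_4_ii_sync := by
    rintro ⟨_ | _⟩ ⟨_ | _⟩ hUU' x hP
    · exact Bool.noConfusion hUU'.1
    · exact Bool.noConfusion hUU'.1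
    · exact absurd hP.kernel_eq (hB x)
    · exact Bool.noConfusion hUU'.2
  have hT : M.Prop_1_4_ii_transgression := by
    rintro ⟨_ | _⟩ ⟨_ | _⟩ hUU' x hP
    · exact Bool.noConfusion hUU'.1
    · exact Bool.noConfusion hUU'.1
    · exact absurd hP.kernel_eq (hB x)
    · exact Bool.noConfusion hUU'.2
  -- yet Thm. 1.9 (b) fails at the rational cusp `z₁`
  have hrat : ∀ c : (M.cusps (ULift.up true)).Cusp, (M.cusps (ULift.up true)).IsRational c := by
    rintro (_ | _) g - <;> exact ⟨((1, 1), g), (MonoidHom.mem_ker).2 rfl, rfl⟩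
  obtain ⟨φ, -⟩ := h M h14i h14 h142 hsync hT (ULift.up true) (ULift.up false) ⟨rfl, rfl⟩ trivial
    trivial trivial le_rfl hrat false (hfree false)
  haveI : Subsingleton (CyclotomeMod (M.ext (ULift.up false)) ZHatCoeff.{0}) :=
    CyclotomeMod.subsingleton_of_geom_eq_bot Ept _ hEpt
  haveI : Subsingleton (CU.Icusp false) := φ.injective.subsingleton
  exact not_isFreeProcyclic_of_subsingleton (hfree false)

end CurveModel

end AbsTopIII

end Literature.AnabelianGeometry.AbsoluteAnabelian

end
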